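import Mathlib.Algebra.Order.Floor.Defs
import Mathlib.Algebra.Order.Floor.Ring
import Mathlib.Algebra.Order.Field.Basic
import Mathlib.Algebra.Ring.Parity
import Mathlib.Order.Interval.Finset.Nat
import Mathlib.Tactic.Linarith
import Mathlib.Tactic.Positivity
import Mathlib.Tactic.Ring
import Mathlib.Tactic.FieldSimp
import Literature.ComputerArithmetic.P3109.StochasticModes
import HarnessLib

/-!
# Limited-randomness SR (P3109 StochasticA/B/C), I: exact away-counts and away-probabilities

HONEST FRAMING: certified error envelopes and provably optimal rounding/accumulation schemes for
low-precision formats under stated cost models; every table by two implementations; no hardware or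
vendor claims.

Venture CertifiedArithmetic / lowprec, SR slice. New work over the published P3109 decision rules
(`Literature.ComputerArithmetic.P3109`: `StochasticA/B/C`, `RNITE`, [FitzgibbonWintersteigerSarnoff2026]
Fig. 2): with `N` uniformly random bits and truncated fraction `0 ≤ η < 1`, the number of random words
that round away from zero is EXACTLY `⌊η 2^N⌋` (A), `⌊η 2^N + 1/2⌋` (B, via
`⌊(⌊2y⌋ + 1)/2⌋ = ⌊y + 1/2⌋`), `RNITE(η 2^N)` (C) — `awayCount_stochasticA/B/B'/C`; hence the
away-probabilities `probAwayA/B/C` and their deviation from the exact-SR probability `η`: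
A in `(−2^{-N}, 0]` (towards zero), B and C within `±2^{-(N+1)}`; each maps `[0,1]` into `[0,1]`.
File II (`SRLimitedBits`) turns these into per-step and n-step bias bounds in the saturating
finite-format model. Input-averaged bias statements for these modes (SRFF/SRF/SRC) are
[FitzgibbonFelix2025] §III; the per-input probabilities here are what the cell's P3109 tables tabulate.
-/

namespace Summit.Ventures.CertifiedArithmetic.LowPrec.SR.LimitedBits

open Literature.ComputerArithmetic.P3109
open Finset

variable {K : Type*} [Field K] [LinearOrder K] [IsStrictOrderedRing K] [FloorRing K]

/-! ### Exact away-counts for `N` random bits -/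

/-- Number of random words `R < 2^N` for which the mode rounds away from zero (`= 2^N · P(away)` for
uniformly distributed random bits). -/
def awayCount (mode : ℕ → ℕ → K → Prop) [∀ N R η, Decidable (mode N R η)] (N : ℕ) (η : K) : ℕ :=
  ((Finset.range (2 ^ N)).filter (fun R => mode N R η)).card

/-! ### Counting lemmas (elementary; proved) -/

omit [Field K] [LinearOrder K] [IsStrictOrderedRing K] [FloorRing K] in
/-- For `m ≤ t`, exactly `m` of the `R < t` satisfy
`t ≤ m + R`. -/
theorem card_filter_threshold (t m : ℕ) (hm : m ≤ t) :
    ((Finset.range t).filter (fun R => t ≤ m + R)).card = m := by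
  have : (Finset.range t).filter (fun R => t ≤ m + R) = Finset.Ico (t - m) t := by
    ext R
    simp only [Finset.mem_filter, Finset.mem_range, Finset.mem_Ico]
    omega
  rw [this, Nat.card_Ico]
  omega

omit [Field K] [LinearOrder K] [IsStrictOrderedRing K] [FloorRing K] in
/-- For `m < 2t`, exactly `⌊(m+1)/2⌋` of the
`R < t` satisfy `2t ≤ m + (2R + 1)`. -/
theorem card_filter_threshold_odd (t m : ℕ) (hm : m < 2 * t) :
    ((Finset.range t).filter (fun R => 2 * t ≤ m + (2 * R + 1))).card = (m + 1) / 2 := by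
  have : (Finset.range t).filter (fun R => 2 * t ≤ m + (2 * R + 1)) =
      Finset.Ico (t - (m + 1) / 2) t := by
    ext R
    simp only [Finset.mem_filter, Finset.mem_range, Finset.mem_Ico]
    omega
  rw [this, Nat.card_Ico]
  omega

/-- The scaled fraction `η·2^N` has floor in `[0, 2^N)` when `0 ≤ η < 1`. -/
theorem floor_scaled_bounds {η : K} (h0 : 0 ≤ η) (h1 : η < 1) (N : ℕ) :
    0 ≤ ⌊η * 2 ^ N⌋ ∧ ⌊η * 2 ^ N⌋ < (2 : ℤ) ^ N := by
  refine ⟨Int.floor_nonneg.mpr (by positivity), ?_⟩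
  rw [Int.floor_lt]
  have : η * 2 ^ N < 1 * 2 ^ N := by
    exact mul_lt_mul_of_pos_right h1 (by positivity)
  push_cast
  linarith

/-- **StochasticA away-count**: for `0 ≤ η < 1`,
exactly `⌊η 2^N⌋` of the `2^N` random words round away from zero, i.e. `P_A(away) = ⌊η 2^N⌋ / 2^N`
(`≤ η`, deficit `< 2^{-N}`: biased towards zero). -/
theorem awayCount_stochasticA {η : K} (h0 : 0 ≤ η) (h1 : η < 1) (N : ℕ) :
    (awayCount StochasticA N η : ℤ) = ⌊η * 2 ^ N⌋ := by
  obtain ⟨hm0, hmt⟩ := floor_scaled_bounds h0 h1 N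
  set m : ℤ := ⌊η * 2 ^ N⌋ with hm
  have key : (Finset.range (2 ^ N)).filter (fun R => StochasticA N R η) =
      (Finset.range (2 ^ N)).filter (fun R => 2 ^ N ≤ m.toNat + R) := by
    apply Finset.filter_congr
    intro R _
    unfold StochasticA
    rw [← hm]
    have h2 : ((2 : ℤ) ^ N) = ((2 ^ N : ℕ) : ℤ) := by push_cast; ring
    constructor
    · intro h; zify; rw [Int.toNat_of_nonneg hm0]; rw [h2] at h; exact_mod_cast h
    · intro h; zify at h; rw [Int.toNat_of_nonneg hm0] at h; rw [h2]; exact_mod_cast h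
  unfold awayCount
  rw [key, card_filter_threshold]
  · exact Int.toNat_of_nonneg hm0
  · have : m.toNat < 2 ^ N := by
      have := Int.toNat_lt_toNat (by positivity : (0:ℤ) < 2 ^ N) |>.mpr hmt
      simpa using this
    exact this.le

/-- **StochasticB away-count**: for `0 ≤ η < 1`,
exactly `⌊(⌊η 2^(N+1)⌋ + 1)/2⌋` random words round away from zero. -/
theorem awayCount_stochasticB {η : K} (h0 : 0 ≤ η) (h1 : η < 1) (N : ℕ) :
    (awayCount StochasticB N η : ℤ) = (⌊η * 2 ^ (N + 1)⌋ + 1) / 2 := by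
  obtain ⟨hm0, hmt⟩ := floor_scaled_bounds h0 h1 (N + 1)
  set m : ℤ := ⌊η * 2 ^ (N + 1)⌋ with hm
  have key : (Finset.range (2 ^ N)).filter (fun R => StochasticB N R η) =
      (Finset.range (2 ^ N)).filter (fun R => 2 * 2 ^ N ≤ m.toNat + (2 * R + 1)) := by
    apply Finset.filter_congr
    intro R _
    unfold StochasticB
    rw [← hm]
    have h2 : ((2 : ℤ) ^ (N + 1)) = ((2 * 2 ^ N : ℕ) : ℤ) := by push_cast; ring
    constructor
    · intro h; zify; rw [Int.toNat_of_nonneg hm0]; rw [h2] at h; exact_mod_cast h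
    · intro h; zify at h; rw [Int.toNat_of_nonneg hm0] at h; rw [h2]; exact_mod_cast h
  unfold awayCount
  rw [key, card_filter_threshold_odd]
  · have := Int.toNat_of_nonneg hm0
    omega
  · have : m.toNat < 2 ^ (N + 1) := by
      have := Int.toNat_lt_toNat (by positivity : (0:ℤ) < 2 ^ (N + 1)) |>.mpr hmt
      simpa using this
    rw [pow_succ] at this
    omega

/-- The StochasticB count in closed form: `⌊(⌊2y⌋ + 1)/2⌋ = ⌊y + 1/2⌋` (`y = η 2^N`), so
`P_B(away) = ⌊η 2^N + 1/2⌋ / 2^N` (within `2^{-(N+1)}` of `η`). -/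
theorem floor_two_mul_add_one_div_two (y : K) : (⌊2 * y⌋ + 1) / 2 = ⌊y + 1 / 2⌋ := by
  have hk := Int.floor_le y
  have hk' := Int.lt_floor_add_one y
  set k : ℤ := ⌊y⌋
  by_cases hf : y < k + 1 / 2
  · have h2 : ⌊2 * y⌋ = 2 * k := by
      rw [Int.floor_eq_iff]; push_cast; constructor <;> linarith
    have h3 : ⌊y + 1 / 2⌋ = k := by
      rw [Int.floor_eq_iff]; constructor <;> linarith
    rw [h2, h3]; omega
  · have hf : (k : K) + 1 / 2 ≤ y := not_lt.mp hf
    have h2 : ⌊2 * y⌋ = 2 * k + 1 := by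
      rw [Int.floor_eq_iff]; push_cast; constructor <;> linarith
    have h3 : ⌊y + 1 / 2⌋ = k + 1 := by
      rw [Int.floor_eq_iff]; push_cast; constructor <;> linarith
    rw [h2, h3]; omega

/-- **StochasticB away-count, closed form**:
`awayCount B = ⌊η 2^N + 1/2⌋`. -/
theorem awayCount_stochasticB' {η : K} (h0 : 0 ≤ η) (h1 : η < 1) (N : ℕ) :
    (awayCount StochasticB N η : ℤ) = ⌊η * 2 ^ N + 1 / 2⌋ := by
  rw [awayCount_stochasticB h0 h1 N, ← floor_two_mul_add_one_div_two]
  congr 2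
  ring_nf

/-- `RNITE` is within `1/2` of its argument. -/
theorem abs_rnite_sub_le (X : K) : |(rnite X : K) - X| ≤ 1 / 2 := by
  have hk := Int.floor_le X
  have hk' := Int.lt_floor_add_one X
  unfold rnite
  split_ifs with h1 h2 h3 <;> push_cast <;> rw [abs_le] <;> constructor <;> linarith

omit [IsStrictOrderedRing K] in
/-- `RNITE(X)` lies between `⌊X⌋` and `⌊X⌋ + 1`. -/
theorem floor_le_rnite (X : K) : ⌊X⌋ ≤ rnite X ∧ rnite X ≤ ⌊X⌋ + 1 := by
  unfold rnite
  split_ifs <;> constructor <;> omega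

/-- **StochasticC away-count**: for `0 ≤ η < 1`,
exactly `RNITE(η 2^N)` random words round away from zero (`|RNITE(η2^N)/2^N − η| ≤ 2^{-(N+1)}`). -/
theorem awayCount_stochasticC {η : K} (h0 : 0 ≤ η) (h1 : η < 1) (N : ℕ) :
    (awayCount StochasticC N η : ℤ) = rnite (η * 2 ^ N) := by
  obtain ⟨hm0, hmt⟩ := floor_scaled_bounds h0 h1 N
  obtain ⟨hr0, hr1⟩ := floor_le_rnite (η * 2 ^ N)
  set r : ℤ := rnite (η * 2 ^ N) with hr
  have hr0' : 0 ≤ r := hm0.trans hr0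
  have hrt : r ≤ 2 ^ N := by omega
  have key : (Finset.range (2 ^ N)).filter (fun R => StochasticC N R η) =
      (Finset.range (2 ^ N)).filter (fun R => 2 ^ N ≤ r.toNat + R) := by
    apply Finset.filter_congr
    intro R _
    unfold StochasticC
    rw [← hr]
    have h2 : ((2 : ℤ) ^ N) = ((2 ^ N : ℕ) : ℤ) := by push_cast; ring
    constructor
    · intro h; zify; rw [Int.toNat_of_nonneg hr0']; rw [h2] at h; exact_mod_cast h
    · intro h; zify at h; rw [Int.toNat_of_nonneg hr0'] at h; rw [h2]; exact_mod_cast h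
  unfold awayCount
  rw [key, card_filter_threshold]
  · exact Int.toNat_of_nonneg hr0'
  · have : (r.toNat : ℤ) ≤ 2 ^ N := by rw [Int.toNat_of_nonneg hr0']; exact hrt
    exact_mod_cast this


/-! ### Away-probabilities and their deviation from exact SR -/

/-- `P_A(away) = ⌊η 2^N⌋ / 2^N`. -/
def probAwayA (N : ℕ) (η : K) : K := (⌊η * 2 ^ N⌋ : K) / 2 ^ N

/-- `P_B(away) = ⌊η 2^N + 1/2⌋ / 2^N`. -/
def probAwayB (N : ℕ) (η : K) : K := (⌊η * 2 ^ N + 1 / 2⌋ : K) / 2 ^ N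

/-- `P_C(away) = RNITE(η 2^N) / 2^N`. -/
def probAwayC (N : ℕ) (η : K) : K := (rnite (η * 2 ^ N) : K) / 2 ^ N

/-- The away-count of StochasticA divided by `2^N` is `probAwayA`. -/
theorem awayCount_stochasticA_div {η : K} (h0 : 0 ≤ η) (h1 : η < 1) (N : ℕ) :
    (awayCount StochasticA N η : K) / 2 ^ N = probAwayA N η := by
  unfold probAwayA; congr 1; exact_mod_cast awayCount_stochasticA h0 h1 N

/-- The away-count of StochasticB divided by `2^N` is `probAwayB`. -/
theorem awayCount_stochasticB_div {η : K} (h0 : 0 ≤ η) (h1 : η < 1) (N : ℕ) :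
    (awayCount StochasticB N η : K) / 2 ^ N = probAwayB N η := by
  unfold probAwayB; congr 1; exact_mod_cast awayCount_stochasticB' h0 h1 N

/-- The away-count of StochasticC divided by `2^N` is `probAwayC`. -/
theorem awayCount_stochasticC_div {η : K} (h0 : 0 ≤ η) (h1 : η < 1) (N : ℕ) :
    (awayCount StochasticC N η : K) / 2 ^ N = probAwayC N η := by
  unfold probAwayC; congr 1; exact_mod_cast awayCount_stochasticC h0 h1 N

/-- StochasticA never rounds away more often than exact SR: `P_A(away) ≤ η`. -/
theorem probAwayA_le (N : ℕ) (η : K) : probAwayA N η ≤ η := by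
  unfold probAwayA
  rw [div_le_iff₀ (by positivity)]
  exact Int.floor_le _

/-- ... and the deficit is `< 2^{-N}`: `η − 2^{-N} < P_A(away)`. -/
theorem sub_lt_probAwayA (N : ℕ) (η : K) : η - 1 / 2 ^ N < probAwayA N η := by
  unfold probAwayA
  have h := Int.lt_floor_add_one (η * 2 ^ N)
  have h2 : (0 : K) < 2 ^ N := by positivity
  rw [sub_lt_iff_lt_add, ← add_div, lt_div_iff₀ h2]
  linarith

/-- `|P_A(away) − η| ≤ 2^{-N}` on `[0,1]` (indeed `< 2^{-N}`, one-sided). -/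
theorem abs_probAwayA_sub_le (N : ℕ) (η : K) : |probAwayA N η - η| ≤ 1 / 2 ^ N := by
  rw [abs_le]; constructor <;> linarith [probAwayA_le N η, sub_lt_probAwayA N η]

/-- `|P_B(away) − η| ≤ 2^{-(N+1)}`. -/
theorem abs_probAwayB_sub_le (N : ℕ) (η : K) : |probAwayB N η - η| ≤ 1 / 2 ^ (N + 1) := by
  unfold probAwayB
  have h := Int.floor_le (η * 2 ^ N + 1 / 2)
  have h' := Int.lt_floor_add_one (η * 2 ^ N + 1 / 2)
  have h2 : (0 : K) < 2 ^ N := by positivity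
  rw [abs_le]; constructor
  · rw [show -(1 / (2:K) ^ (N + 1)) = (η * 2 ^ N - 1 / 2) / 2 ^ N - η by field_simp; ring]
    rw [sub_le_sub_iff_right, div_le_div_iff_of_pos_right h2]; linarith
  · rw [show (1 / (2:K) ^ (N + 1)) = (η * 2 ^ N + 1 / 2) / 2 ^ N - η by field_simp; ring]
    rw [sub_le_sub_iff_right, div_le_div_iff_of_pos_right h2]; exact h

/-- `|P_C(away) − η| ≤ 2^{-(N+1)}`. -/
theorem abs_probAwayC_sub_le (N : ℕ) (η : K) : |probAwayC N η - η| ≤ 1 / 2 ^ (N + 1) := by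
  unfold probAwayC
  have h := abs_rnite_sub_le (η * 2 ^ N)
  have h2 : (0 : K) < 2 ^ N := by positivity
  rw [show (rnite (η * 2 ^ N) : K) / 2 ^ N - η = ((rnite (η * 2 ^ N) : K) - η * 2 ^ N) / 2 ^ N by
    field_simp]
  rw [abs_div, abs_of_pos h2, div_le_iff₀ h2]
  rw [show (1:K) / 2 ^ (N + 1) * 2 ^ N = 1 / 2 by field_simp; ring]
  exact h


/-! ### The three P3109 rules as instances -/

/-- `probAwayA` maps `[0,1]` into `[0,1]`. -/
theorem probAwayA_mem (N : ℕ) (η : K) (h0 : 0 ≤ η) (h1 : η ≤ 1) :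
    0 ≤ probAwayA N η ∧ probAwayA N η ≤ 1 := by
  refine ⟨?_, (probAwayA_le N η).trans h1⟩
  unfold probAwayA
  exact div_nonneg (by exact_mod_cast Int.floor_nonneg.mpr (by positivity)) (by positivity)

/-- `probAwayB` maps `[0,1]` into `[0,1]`. -/
theorem probAwayB_mem (N : ℕ) (η : K) (h0 : 0 ≤ η) (h1 : η ≤ 1) :
    0 ≤ probAwayB N η ∧ probAwayB N η ≤ 1 := by
  unfold probAwayB
  have h2 : (0 : K) < 2 ^ N := by positivity
  constructor
  · exact div_nonneg (by exact_mod_cast Int.floor_nonneg.mpr (by positivity)) h2.le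
  · rw [div_le_one h2]
    have : ⌊η * 2 ^ N + 1 / 2⌋ ≤ ((2 ^ N : ℕ) : ℤ) := by
      rw [Int.floor_le_iff]; push_cast; nlinarith
    exact_mod_cast this

/-- `probAwayC` maps `[0,1]` into `[0,1]`. -/
theorem probAwayC_mem (N : ℕ) (η : K) (h0 : 0 ≤ η) (h1 : η ≤ 1) :
    0 ≤ probAwayC N η ∧ probAwayC N η ≤ 1 := by
  unfold probAwayC
  have h2 : (0 : K) < 2 ^ N := by positivity
  obtain ⟨hr0, hr1⟩ := floor_le_rnite (η * 2 ^ N)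
  have hf0 : 0 ≤ ⌊η * 2 ^ N⌋ := Int.floor_nonneg.mpr (by positivity)
  constructor
  · exact div_nonneg (by exact_mod_cast hf0.trans hr0) h2.le
  · rw [div_le_one h2]
    -- rnite X ≤ X + 1/2 ≤ 2^N + 1/2, and rnite X is an integer; sharper: use |rnite X - X| ≤ 1/2
    have hab := abs_rnite_sub_le (η * 2 ^ N)
    rw [abs_le] at hab
    have hX : η * 2 ^ N ≤ 2 ^ N := by nlinarith
    -- rnite ≤ 2^N + 1/2 and integer ⇒ ≤ 2^N
    have hlt : (rnite (η * 2 ^ N) : K) < (2 ^ N : ℕ) + 1 := by push_cast; linarith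
    have : rnite (η * 2 ^ N) < ((2 ^ N : ℕ) : ℤ) + 1 := by exact_mod_cast hlt
    have : rnite (η * 2 ^ N) ≤ ((2 ^ N : ℕ) : ℤ) := by omega
    exact_mod_cast this

end Summit.Ventures.CertifiedArithmetic.LowPrec.SR.LimitedBits
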